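/-
Copyright: b2b-lace packet (enumeration shard A, gen 9).  The one-step END-POINT RECURSION for the
self-avoiding-walk counts `c_n(x) = #sawWordsTo d n x` with an avoidance set, its invariance under the
signed coordinate permutations `W_d`, and the FRESH-DIMENSION COLLAPSE: from a configuration supported on
the first `m` coordinates, the `2(d - m)` steps into unused coordinates all count the same.  Pure
combinatorics over the tree's own definitions; no numerals; nothing of the record is touched.
-/
import Literature.Probability.FitznerVanDerHofstad2017.SawEndpointClasses
import Literature.Probability.FitznerVanDerHofstad2017.NbwTwoStepRecursion
import HarnessLib

/-!
# The end-point recursion for self-avoiding walk counts and the fresh-dimension collapse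

CITATION HEADER (PLACEMENT v2). This module is part of a certified REPRODUCTION of:
R. Fitzner, R. van der Hofstad, *Mean-field behavior for nearest-neighbor percolation in d > 10*,
Electron. J. Probab. 22 (2017), no. 43, 1–65 [FvdH17], and *Generalized approach to the non-backtracking
lace expansion*, Probab. Theory Related Fields 169 (2017), 1041–1119 [NoBLE17-I] (arXiv:1506.07977, 1506.07969).
Reproduces: the INPUT TABLE `nrSAW[n,d,x]` of the accompanying Mathematica notebook `SRW.nb` §3
("number of n-step self-avoiding walks from 0 to x in ℤ^d", given there as explicit polynomials in `d` for
`n ≤ 10`), here DERIVED from the tree's definition of self-avoiding step words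
(`Percolation.sawWordsTo d n x`, `SusceptibilityPathCounting`).  This file is the combinatorial half: the
numbers themselves are evaluated by the kernel in `SawCountKernel` / `SawCountTables`.

## What is here (all `[folklore]`; N. Madras, G. Slade, *The Self-Avoiding Walk* (1993), §1.1–1.2 for the
objects)

* `isSAW_wordSnoc_iff`: appending a step keeps self-avoidance iff the new site is new;
* `sawWordsToAvoid d n y A`: the self-avoiding words of length `n` ending at `y` none of whose sites lies in
  the finite set `A`, and the recursion `sawCount d n y A` with
  **`card_sawWordsToAvoid : #sawWordsToAvoid d n y A = sawCount d n y A`** (split off the last step: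
  `c_{n+1}(y; A) = [y ∉ A] Σ_e c_n(y - e; A ∪ {y})`, `c_0(y; A) = [y ∉ A][y = 0]`), whence
  **`card_sawWordsTo_eq_sawCount : #sawWordsTo d n y = sawCount d n y ∅`**;
* **`sawCount_signedPerm`**: `c_n(φ y; φ A) = c_n(y; A)` for every signed coordinate permutation `φ`
  (the explicit action `stepPerm` of `SawEndpointClasses` on the steps);
* `l1Norm`, `sawCount_eq_zero_of_lt` (`c_n(y; A) = 0` if `n < ‖y‖₁`), `sawCount_eq_zero_of_odd` (parity);
* `bvec d i` (the `i`-th unit vector, `0` if `i ≥ d`), `SuppBelow m y` (`y_k = 0` for `k ≥ m`) and the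
  **fresh-dimension collapse** `sawCount_succ_of_suppBelow`: if `y` and `A` are supported on the first
  `m ≤ d` coordinates and `y ∉ A`, then
  `c_{n+1}(y; A) = Σ_{i<m} (c_n(y + e_i; A') + c_n(y - e_i; A')) + 2(d - m) · c_n(y + e_m; A')`, `A' = A ∪ {y}`
  — the `2(d - m)` steps into unused coordinates are conjugate under `W_d` elements fixing `y` and `A`.
  Iterating, `c_n(x)` for `x` supported on `s` coordinates is a polynomial in `d` of degree at most
  `(n - ‖x‖₁)/2` whose coefficients count walks with canonically labelled fresh coordinates
  (`SawCountKernel`).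

## What is NOT here

No numeral, no dimension is fixed, no cell of the record; no cited fact, no named hypothesis, no `sorry`.

## References
* N. Madras, G. Slade, The Self-Avoiding Walk, Birkhäuser (1993), §1.1 (c_n(0,x)), §1.2.
* R. Fitzner, R. van der Hofstad, Mathematica notebook SRW.nb (2015), §3 "number of SAWs" (the table
  `nrSAW[n,d,x]`, polynomials in d), accompanying [FvdH17]/[NoBLE17-I], arXiv:1506.07977 anc.
-/

namespace Literature.Probability.FitznerVanDerHofstad2017

open Finset Literature.Probability.LatticeModels Literature.Probability.Percolation
open Literature.Barriers.CriticalPhenomena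

variable {d : ℕ}

/-! ### Appending a step and self-avoidance -/

/-- **Appending a step keeps self-avoidance iff the new end point is a new site.** [folklore] -/
theorem isSAW_wordSnoc_iff {n : ℕ} (u : Fin n → Fin d × Bool) (s : Fin d × Bool) :
    IsSAW (wordSnoc u s) ↔ IsSAW u ∧ ∀ k ≤ n, wordPos u k ≠ wordPos u n + stepVec s := by
  constructor
  · intro h
    refine ⟨fun i j hi hj hij => ?_, fun k hk hne => ?_⟩
    · exact h i j (by omega) (by omega)
        (by rwa [wordPos_wordSnoc_of_le u s hi, wordPos_wordSnoc_of_le u s hj])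
    · have := h k (n + 1) (by omega) le_rfl
        (by rw [wordPos_wordSnoc_of_le u s hk, wordPos_wordSnoc_succ]; exact hne)
      omega
  · rintro ⟨hu, hne⟩ i j hi hj hij
    rcases Nat.lt_or_ge i (n + 1) with hi' | hi' <;> rcases Nat.lt_or_ge j (n + 1) with hj' | hj'
    · have hi2 : i ≤ n := by omega
      have hj2 : j ≤ n := by omega
      rw [wordPos_wordSnoc_of_le u s hi2, wordPos_wordSnoc_of_le u s hj2] at hij
      exact hu i j hi2 hj2 hij
    · obtain rfl : j = n + 1 := by omega
      have hi2 : i ≤ n := by omega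
      rw [wordPos_wordSnoc_of_le u s hi2, wordPos_wordSnoc_succ] at hij
      exact absurd hij (hne i hi2)
    · obtain rfl : i = n + 1 := by omega
      have hj2 : j ≤ n := by omega
      rw [wordPos_wordSnoc_of_le u s hj2, wordPos_wordSnoc_succ] at hij
      exact absurd hij.symm (hne j hj2)
    · omega

/-! ### Self-avoiding words avoiding a set, and the recursion -/

open Classical in
/-- The self-avoiding words of length `n` ending at `y` whose sites `w(0), …, w(n)` all lie outside `A`.
[folklore] -/
noncomputable def sawWordsToAvoid (d n : ℕ) (y : Site d) (A : Finset (Site d)) :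
    Finset (Fin n → Fin d × Bool) :=
  (sawWordsTo d n y).filter fun w => ∀ k ≤ n, wordPos w k ∉ A

/-- Membership in `sawWordsToAvoid`. [folklore] -/
theorem mem_sawWordsToAvoid {n : ℕ} {y : Site d} {A : Finset (Site d)} {w : Fin n → Fin d × Bool} :
    w ∈ sawWordsToAvoid d n y A ↔ IsSAW w ∧ wordPos w n = y ∧ ∀ k ≤ n, wordPos w k ∉ A := by
  rw [sawWordsToAvoid, mem_filter, mem_sawWordsTo, and_assoc]

/-- With nothing to avoid these are all the self-avoiding words ending at `y`. [folklore] -/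
theorem sawWordsToAvoid_empty (n : ℕ) (y : Site d) : sawWordsToAvoid d n y ∅ = sawWordsTo d n y := by
  ext w
  simp [mem_sawWordsToAvoid, mem_sawWordsTo]

open Classical in
/-- The end-point recursion: `sawCount d 0 y A = [y ∉ A][y = 0]`,
`sawCount d (n+1) y A = [y ∉ A] Σ_e sawCount d n (y - e) (A ∪ {y})` (sum over the `2d` unit steps `e`).
[folklore] -/
noncomputable def sawCount (d : ℕ) : ℕ → Site d → Finset (Site d) → ℕ
  | 0, y, A => if y ∈ A then 0 else if y = 0 then 1 else 0
  | n + 1, y, A => if y ∈ A then 0 else ∑ a : Fin d × Bool, sawCount d n (y - stepVec a) (insert y A)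

/-- `sawCount` vanishes on `A`. [folklore] -/
theorem sawCount_of_mem {n : ℕ} {y : Site d} {A : Finset (Site d)} (h : y ∈ A) : sawCount d n y A = 0 := by
  cases n <;> simp [sawCount, h]

/-- The zero-step value off `A`. [folklore] -/
theorem sawCount_zero_of_not_mem {y : Site d} {A : Finset (Site d)} (h : y ∉ A) :
    sawCount d 0 y A = if y = 0 then 1 else 0 := by
  simp [sawCount, h]

/-- The recursion step off `A`. [folklore] -/
theorem sawCount_succ_of_not_mem (n : ℕ) {y : Site d} {A : Finset (Site d)} (h : y ∉ A) :
    sawCount d (n + 1) y A = ∑ a : Fin d × Bool, sawCount d n (y - stepVec a) (insert y A) := by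
  simp [sawCount, h]

/-- **The recursion counts**: `#sawWordsToAvoid d n y A = sawCount d n y A` (split off the last step).
[folklore] -/
theorem card_sawWordsToAvoid (n : ℕ) :
    ∀ (y : Site d) (A : Finset (Site d)), (sawWordsToAvoid d n y A).card = sawCount d n y A := by
  induction n with
  | zero =>
    intro y A
    by_cases hA : y ∈ A
    · rw [sawCount_of_mem hA, card_eq_zero, eq_empty_iff_forall_notMem]
      intro w hw
      rw [mem_sawWordsToAvoid] at hw
      have hy0 : y = 0 := by rw [← hw.2.1, wordPos_zero]
      subst hy0
      exact hw.2.2 0 le_rfl (by simpa using hA)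
    · rw [sawCount_zero_of_not_mem hA]
      by_cases hy : y = 0
      · subst hy
        rw [if_pos rfl, card_eq_one]
        refine ⟨fun i => i.elim0, eq_singleton_iff_unique_mem.2 ⟨?_, fun w _ => funext fun i => i.elim0⟩⟩
        rw [mem_sawWordsToAvoid]
        refine ⟨fun i j hi hj _ => by omega, wordPos_zero _, fun k hk => ?_⟩
        obtain rfl : k = 0 := by omega
        simpa using hA
      · rw [if_neg hy, card_eq_zero, eq_empty_iff_forall_notMem]
        intro w hw
        rw [mem_sawWordsToAvoid] at hw
        exact hy (by rw [← hw.2.1, wordPos_zero])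
  | succ n ih =>
    intro y A
    by_cases hA : y ∈ A
    · rw [sawCount_of_mem hA, card_eq_zero, eq_empty_iff_forall_notMem]
      intro w hw
      rw [mem_sawWordsToAvoid] at hw
      exact hw.2.2 (n + 1) le_rfl (by rw [hw.2.1]; exact hA)
    · rw [sawCount_succ_of_not_mem n hA]
      simp_rw [← ih]
      rw [← card_sigma]
      refine card_nbij' (fun w => ⟨w ⟨n, lt_add_one n⟩, wordInit w⟩) (fun p => wordSnoc p.2 p.1)
        ?_ ?_ ?_ ?_
      · intro w hw
        simp only [mem_coe, mem_sawWordsToAvoid] at hw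
        obtain ⟨hs, hy, hav⟩ := hw
        simp only [mem_coe, mem_sigma, mem_univ, true_and, mem_sawWordsToAvoid]
        have hlast : wordPos w n + stepVec (w ⟨n, lt_add_one n⟩) = y := by
          rw [← wordPos_succ w (lt_add_one n), hy]
        refine ⟨fun i j hi hj hij => hs i j (by omega) (by omega) ?_, ?_, fun k hk => ?_⟩
        · rwa [wordPos_wordInit w hi, wordPos_wordInit w hj] at hij
        · rw [wordPos_wordInit w le_rfl, eq_sub_iff_add_eq, hlast]
        · rw [wordPos_wordInit w hk, mem_insert, not_or]
          refine ⟨fun hk' => ?_, hav k (by omega)⟩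
          have := hs k (n + 1) (by omega) le_rfl (by rw [hk', hy])
          omega
      · rintro ⟨a, u⟩ hp
        simp only [mem_coe, mem_sigma, mem_univ, true_and, mem_sawWordsToAvoid] at hp
        obtain ⟨hs, hy, hav⟩ := hp
        simp only [mem_coe, mem_sawWordsToAvoid]
        have hend : wordPos u n + stepVec a = y := by rw [hy, sub_add_cancel]
        refine ⟨(isSAW_wordSnoc_iff u a).2 ⟨hs, fun k hk => ?_⟩, ?_, fun k hk => ?_⟩
        · rw [hend]
          exact fun h => hav k hk (by rw [h]; exact mem_insert_self y A)
        · rw [wordPos_wordSnoc_succ, hend]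
        · rcases Nat.lt_or_ge k (n + 1) with hk' | hk'
          · rw [wordPos_wordSnoc_of_le u a (show k ≤ n by omega)]
            exact fun h => hav k (by omega) (mem_insert_of_mem h)
          · obtain rfl : k = n + 1 := by omega
            rwa [wordPos_wordSnoc_succ, hend]
      · intro w _
        exact wordSnoc_wordInit w
      · rintro ⟨a, u⟩ _
        simp

/-- **`c_n(y) = sawCount d n y ∅`**: the self-avoiding walk counts satisfy the end-point recursion.
[folklore] -/
theorem card_sawWordsTo_eq_sawCount (n : ℕ) (y : Site d) :
    (sawWordsTo d n y).card = sawCount d n y ∅ := by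
  rw [← sawWordsToAvoid_empty, card_sawWordsToAvoid]

/-! ### Invariance under the signed coordinate permutations -/

/-- **`W_d`-invariance of the recursion**: `sawCount d n (φ y) (φ A) = sawCount d n y A`. [folklore] -/
theorem sawCount_signedPerm (π : Equiv.Perm (Fin d)) (ε : Fin d → ℤˣ) (n : ℕ) :
    ∀ (y : Site d) (A : Finset (Site d)),
      sawCount d n (Site.signedPerm π ε y) (A.image (Site.signedPerm π ε)) = sawCount d n y A := by
  have hinj := (Site.signedPerm π ε).injective
  induction n with
  | zero =>
    intro y A
    by_cases hA : y ∈ A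
    · rw [sawCount_of_mem hA, sawCount_of_mem (mem_image_of_mem _ hA)]
    · have hA' : Site.signedPerm π ε y ∉ A.image (Site.signedPerm π ε) := by
        rwa [hinj.mem_finset_image]
      rw [sawCount_zero_of_not_mem hA, sawCount_zero_of_not_mem hA']
      simp only [signedPerm_eq_zero_iff]
  | succ n ih =>
    intro y A
    by_cases hA : y ∈ A
    · rw [sawCount_of_mem hA, sawCount_of_mem (mem_image_of_mem _ hA)]
    · have hA' : Site.signedPerm π ε y ∉ A.image (Site.signedPerm π ε) := by
        rwa [hinj.mem_finset_image]
      rw [sawCount_succ_of_not_mem n hA, sawCount_succ_of_not_mem n hA',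
        ← Equiv.sum_comp (stepPerm π ε)]
      refine sum_congr rfl fun a _ => ?_
      rw [← signedPerm_stepVec, ← signedPerm_sub, ← image_insert, ih]

/-! ### The `ℓ¹` norm: vanishing beyond reach and parity -/

/-- `‖y‖₁ = Σ_i |y_i|` as a natural number. [folklore] -/
def l1Norm (y : Site d) : ℕ := ∑ i, (y i).natAbs

/-- `‖y‖₁ = 0 ↔ y = 0`. [folklore] -/
theorem l1Norm_eq_zero_iff (y : Site d) : l1Norm y = 0 ↔ y = 0 := by
  rw [l1Norm, sum_eq_zero_iff]
  constructor
  · intro h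
    funext i
    simpa using h i (mem_univ i)
  · rintro rfl i _
    simp

/-- One unit step changes `‖·‖₁` by exactly one: `‖y - e‖₁ = ‖y‖₁ + 1` or `‖y - e‖₁ + 1 = ‖y‖₁`. [folklore] -/
theorem l1Norm_sub_stepVec (y : Site d) (a : Fin d × Bool) :
    l1Norm (y - stepVec a) = l1Norm y + 1 ∨ l1Norm (y - stepVec a) + 1 = l1Norm y := by
  have hsplit : ∀ z : Site d, l1Norm z = (z a.1).natAbs + ∑ i ∈ univ.erase a.1, (z i).natAbs :=
    fun z => (add_sum_erase _ _ (mem_univ a.1)).symm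
  have hrest : ∑ i ∈ univ.erase a.1, ((y - stepVec a) i).natAbs = ∑ i ∈ univ.erase a.1, (y i).natAbs := by
    refine sum_congr rfl fun i hi => ?_
    have hi' : i ≠ a.1 := ne_of_mem_erase hi
    obtain ⟨k, b⟩ := a
    cases b <;> simp [stepVec, hi']
  have hco : ((y - stepVec a) a.1).natAbs = (y a.1).natAbs + 1 ∨
      ((y - stepVec a) a.1).natAbs + 1 = (y a.1).natAbs := by
    obtain ⟨k, b⟩ := a
    cases b <;> simp [stepVec] <;> omega
  rw [hsplit (y - stepVec a), hsplit y, hrest]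
  omega

/-- **Out of reach**: `sawCount d n y A = 0` when `n < ‖y‖₁`. [folklore] -/
theorem sawCount_eq_zero_of_lt (n : ℕ) :
    ∀ (y : Site d) (A : Finset (Site d)), n < l1Norm y → sawCount d n y A = 0 := by
  induction n with
  | zero =>
    intro y A h
    by_cases hA : y ∈ A
    · exact sawCount_of_mem hA
    · rw [sawCount_zero_of_not_mem hA, if_neg]
      rintro rfl
      simp [l1Norm] at h
  | succ n ih =>
    intro y A h
    by_cases hA : y ∈ A
    · exact sawCount_of_mem hA
    · rw [sawCount_succ_of_not_mem n hA]
      refine sum_eq_zero fun a _ => ih _ _ ?_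
      rcases l1Norm_sub_stepVec y a with h' | h' <;> omega

/-- **Parity**: `sawCount d n y A = 0` when `n + ‖y‖₁` is odd. [folklore] -/
theorem sawCount_eq_zero_of_odd (n : ℕ) :
    ∀ (y : Site d) (A : Finset (Site d)), (n + l1Norm y) % 2 = 1 → sawCount d n y A = 0 := by
  induction n with
  | zero =>
    intro y A h
    by_cases hA : y ∈ A
    · exact sawCount_of_mem hA
    · rw [sawCount_zero_of_not_mem hA, if_neg]
      rintro rfl
      simp [l1Norm] at h
  | succ n ih =>
    intro y A h
    by_cases hA : y ∈ A
    · exact sawCount_of_mem hA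
    · rw [sawCount_succ_of_not_mem n hA]
      refine sum_eq_zero fun a _ => ih _ _ ?_
      rcases l1Norm_sub_stepVec y a with h' | h' <;> omega

/-! ### Unit vectors, support, and the fresh-dimension collapse -/

/-- The `i`-th unit vector of `ℤ^d` (the zero vector if `i ≥ d`). [folklore] -/
def bvec (d i : ℕ) : Site d := fun k => if (k : ℕ) = i then 1 else 0

/-- `e_{(k,+)} = bvec d k`. [folklore] -/
theorem stepVec_true (k : Fin d) : stepVec (k, true) = bvec d k := by
  funext j
  simp [stepVec, bvec, Pi.single_apply, Fin.ext_iff]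

/-- `e_{(k,-)} = -bvec d k`. [folklore] -/
theorem stepVec_false (k : Fin d) : stepVec (k, false) = -bvec d k := by
  funext j
  simp [stepVec, bvec, Pi.single_apply, Fin.ext_iff]

/-- `bvec d k = Pi.single k 1` for `k < d`. [folklore] -/
theorem bvec_eq_single (k : Fin d) : bvec d k = Pi.single k (1 : ℤ) := by
  rw [← stepVec_true]; rfl

/-- `y` is supported on the first `m` coordinates. [folklore] -/
def SuppBelow (m : ℕ) (y : Site d) : Prop := ∀ k : Fin d, m ≤ (k : ℕ) → y k = 0

/-- `SuppBelow` is monotone in `m`. [folklore] -/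
theorem SuppBelow.mono {m m' : ℕ} {y : Site d} (h : SuppBelow m y) (hm : m ≤ m') : SuppBelow m' y :=
  fun k hk => h k (le_trans hm hk)

/-- `0` is supported anywhere. [folklore] -/
theorem suppBelow_zero (m : ℕ) : SuppBelow m (0 : Site d) := fun _ _ => rfl

/-- `y ± e_i` stays supported below `m` for `i < m`. [folklore] -/
theorem SuppBelow.add_bvec {m : ℕ} {y : Site d} (h : SuppBelow m y) {i : ℕ} (hi : i < m) :
    SuppBelow m (y + bvec d i) := fun k hk => by
  simp [bvec, h k hk, show (k : ℕ) ≠ i by omega]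

/-- `y - e_i` stays supported below `m` for `i < m`. [folklore] -/
theorem SuppBelow.sub_bvec {m : ℕ} {y : Site d} (h : SuppBelow m y) {i : ℕ} (hi : i < m) :
    SuppBelow m (y - bvec d i) := fun k hk => by
  simp [bvec, h k hk, show (k : ℕ) ≠ i by omega]

/-- `y + e_m` is supported below `m + 1`. [folklore] -/
theorem SuppBelow.add_bvec_succ {m : ℕ} {y : Site d} (h : SuppBelow m y) :
    SuppBelow (m + 1) (y + bvec d m) := fun k hk => by
  simp [bvec, h k (by omega), show (k : ℕ) ≠ m by omega]

/-- A signed permutation built from a transposition of two coordinates `≥ m` and a sign at one of them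
fixes every vector supported below `m`. [folklore] -/
theorem signedPerm_swap_of_suppBelow {m : ℕ} (i j : Fin d) (hi : m ≤ (i : ℕ)) (hj : m ≤ (j : ℕ))
    (σ : ℤˣ) {z : Site d} (hz : SuppBelow m z) :
    Site.signedPerm (Equiv.swap i j) (Function.update 1 j σ) z = z := by
  have hzi : z i = 0 := hz i hi
  have hzj : z j = 0 := hz j hj
  funext k
  rw [Site.signedPerm_apply, Equiv.symm_swap]
  by_cases hkj : k = j
  · subst hkj
    rw [Equiv.swap_apply_right, hzi, mul_zero, hzj]
  · rw [Function.update_of_ne hkj, Pi.one_apply, Units.val_one, one_mul]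
    by_cases hki : k = i
    · subst hki
      rw [Equiv.swap_apply_left, hzj, hzi]
    · rw [Equiv.swap_apply_of_ne_of_ne hki hkj]

/-- … and sends `e_i` to `σ e_j`. [folklore] -/
theorem signedPerm_swap_bvec (i j : Fin d) (σ : ℤˣ) :
    Site.signedPerm (Equiv.swap i j) (Function.update 1 j σ) (bvec d i) = (σ : ℤ) • bvec d j := by
  rw [bvec_eq_single, Site.signedPerm_single, Equiv.swap_apply_left, Function.update_self, bvec_eq_single]

/-- **Fresh directions are conjugate**: from a configuration supported below `m`, the counts after a step
`+e_i`, `-e_i`, `+e_j`, `-e_j` into any two coordinates `i, j ≥ m` agree. [folklore] -/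
theorem sawCount_fresh_eq {m : ℕ} (n : ℕ) {y : Site d} {A : Finset (Site d)} (hy : SuppBelow m y)
    (hA : ∀ z ∈ A, SuppBelow m z) (i j : Fin d) (hi : m ≤ (i : ℕ)) (hj : m ≤ (j : ℕ)) (σ : ℤˣ) :
    sawCount d n (y + (σ : ℤ) • bvec d j) A = sawCount d n (y + bvec d i) A := by
  have hfix : ∀ z : Site d, SuppBelow m z →
      Site.signedPerm (Equiv.swap i j) (Function.update 1 j σ) z = z :=
    fun z hz => signedPerm_swap_of_suppBelow i j hi hj σ hz
  have himg : A.image (Site.signedPerm (Equiv.swap i j) (Function.update 1 j σ)) = A := by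
    rw [image_congr (show Set.EqOn _ id (A : Set (Site d)) from fun z hz => hfix z (hA z hz)), image_id]
  calc sawCount d n (y + (σ : ℤ) • bvec d j) A
      = sawCount d n (Site.signedPerm (Equiv.swap i j) (Function.update 1 j σ) (y + bvec d i))
          (A.image (Site.signedPerm (Equiv.swap i j) (Function.update 1 j σ))) := by
        rw [Site.signedPerm_add, hfix y hy, signedPerm_swap_bvec, himg]
    _ = sawCount d n (y + bvec d i) A := sawCount_signedPerm _ _ n _ _

/-- **Fresh-dimension collapse.**  If `y ∉ A` and `y`, `A` are supported on the first `m ≤ d` coordinates,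
then `c_{n+1}(y; A) = Σ_{i<m} (c_n(y+e_i; A') + c_n(y-e_i; A')) + 2(d-m)·c_n(y+e_m; A')` with `A' = A ∪ {y}`:
the `2(d-m)` steps into unused coordinates all count the same.  (For `m = d` the last term is `0`.)
[folklore] -/
theorem sawCount_succ_of_suppBelow {m : ℕ} (hm : m ≤ d) (n : ℕ) {y : Site d} {A : Finset (Site d)}
    (hy : SuppBelow m y) (hA : ∀ z ∈ A, SuppBelow m z) (hyA : y ∉ A) :
    sawCount d (n + 1) y A =
      (∑ i ∈ range m,
          (sawCount d n (y + bvec d i) (insert y A) + sawCount d n (y - bvec d i) (insert y A))) +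
        2 * (d - m) * sawCount d n (y + bvec d m) (insert y A) := by
  have hA' : ∀ z ∈ insert y A, SuppBelow m z := by
    intro z hz
    rcases mem_insert.1 hz with rfl | hz
    exacts [hy, hA z hz]
  let g : ℕ → ℕ := fun i =>
    sawCount d n (y + bvec d i) (insert y A) + sawCount d n (y - bvec d i) (insert y A)
  have hsum : ∑ a : Fin d × Bool, sawCount d n (y - stepVec a) (insert y A) = ∑ i ∈ range d, g i := by
    rw [Fintype.sum_prod_type, ← Fin.sum_univ_eq_sum_range]
    refine Fintype.sum_congr _ _ fun k => ?_
    rw [Fintype.sum_bool, stepVec_true, stepVec_false, sub_neg_eq_add, add_comm]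
  rw [sawCount_succ_of_not_mem n hyA, hsum, ← sum_range_add_sum_Ico g hm]
  congr 1
  have hconst : ∀ i ∈ Ico m d, g i = 2 * sawCount d n (y + bvec d m) (insert y A) := by
    intro i hi
    rw [mem_Ico] at hi
    have hmd : m < d := by omega
    have h1 := sawCount_fresh_eq n hy hA' ⟨m, hmd⟩ ⟨i, hi.2⟩ le_rfl hi.1 1
    have h2 := sawCount_fresh_eq n hy hA' ⟨m, hmd⟩ ⟨i, hi.2⟩ le_rfl hi.1 (-1)
    rw [Units.val_one, one_smul] at h1
    rw [Units.val_neg, Units.val_one, neg_smul, one_smul, ← sub_eq_add_neg] at h2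
    show sawCount d n (y + bvec d i) (insert y A) + sawCount d n (y - bvec d i) (insert y A) = _
    rw [h1, h2]
    ring
  rw [sum_congr rfl hconst, sum_const, Nat.card_Ico, smul_eq_mul]
  ring

end Literature.Probability.FitznerVanDerHofstad2017
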